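import Literature.Geometry.Kaehler.ComplexTorusAbelianSurfaceFirstKindHodgeEqLefschetz
import Literature.Geometry.Kaehler.ComplexTorusAbelianSurfaceNonSimple
import Literature.Geometry.Kaehler.ComplexTorusStablyNondegenerateEllipticFactors
import Literature.Geometry.Kaehler.ComplexTorusEllipticCurveIsomorphismClasses
import Literature.Geometry.Kaehler.ComplexTorusPicardNumberFiniteProduct
import HarnessLib

/-!
# Moonen–Zarhin 1999, §3 «condition (D) for every abelian variety of dimension `≤ 3`», at `g = 2`, torus level: a NON-SIMPLE polarised abelian surface is isogenous to a product of two
# elliptic curves `E_{τ₁} × E_{τ₂}`, hence STABLY NONDEGENERATE (`ℬ•(Xⁿ) = 𝒟•(Xⁿ)` for every `n`); consequently EVERY polarised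
# abelian surface which is not a SIMPLE surface of Albert type IV (CM by a quartic field) is stably nondegenerate

Layer `Literature/Geometry/Kaehler`, namespace `Literature.Geometry.Kaehler.ComplexTorus`; lane `lit-hodgefound`
(Track 2 foundations library), Layer A4, prover seat p17 (generation 48), self-proposed row g48-#3 — the non-simple half of
Moonen–Zarhin's «`Hg(X) = Sp_D(V,φ)` and condition (D) for `dim X ≤ 3`» (§3, p0008 L107–L111) for surfaces at torus level and its junction with g48-#2
(`ComplexTorusAbelianSurfaceFirstKindHodgeEqLefschetz`: every SIMPLE surface not of type IV is stably nondegenerate).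
THEOREMS ONLY (no definition, no instance, no notation, no named fact; D-0026, net debt 0); everything consumed BY NAME:
Poincaré reducibility for a non-simple surface (`IsRiemannForm.exists_isIsogenous_prod_elliptic_of_not_isSimple`,
`ComplexTorusAbelianSurfaceNonSimple`: `X ∼ X₁ × X₂` with one-dimensional complex subtori `X₁`, `X₂`), «every one-dimensional
complex torus is an `E_τ`» (`exists_isIsomorphic_ellipticPeriod`, `ComplexTorusEllipticCurveIsomorphismClasses`), the product
plumbing (`IsIsomorphic.prod`, `isIsomorphic_piPeriod_succ`, `piPeriod_const`, `isIsomorphic_powPeriod_one`), and Tate's theorem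
for all powers of every product of elliptic curves (`IsIsogenous.forall_divisorClasses_powPeriod_eq_hodgeClasses_of_pi_ellipticPeriod`,
`ComplexTorusStablyNondegenerateEllipticFactors`, MZ Cor. (3.9)).

## Sources, VERBATIM

* B. J. J. Moonen, Yu. G. Zarhin, *Hodge classes on abelian varieties of low dimension*, Math. Ann. **315** (1999)
  711–733, held `paper:arxiv-math_9901113` (the TeX carries no statement numbers; locators are chunk lines): Introduction
  (p0001 L62–L64) «If `dim(X) ≤ 3` then every Hodge class on `X` is a linear combination of products of divisor classes»;
  §1 condition (D) (p0004 L61–L66) «`ℬ•(Xⁿ) = 𝒟•(Xⁿ)` for all `n`»; §2 (p0005 L20–L22) «For `g := dim(X) ≤ 3` and `g = 5` we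
  always find that `Hg(X) = Sp_D(V,φ)`. Since type III does not occur for `g ≤ 3` and `g = 5` (`X` simple!), it follows that
  `ℬ•(Xⁿ) = 𝒟•(Xⁿ)` for all `n`»; §3 Corollary (p0007 L80–L84) «Let `X_1, …, X_n` be elliptic curves over `ℂ`, no two of
  which are isogenous. Write `X = X_1 × ⋯ × X_n`. Then `Hg(X) = Hg(X_1) × ⋯ × Hg(X_n)`. In particular, every product of
  elliptic curves satisfies condition (D)»; §3 (p0008 L107–L111) «Combining this with Corollary (…), we have proven (…) in
  case `dim(X) ≤ 3`. In particular, for every complex abelian variety `X` of dimension `≤ 3` we have `Hg(X) = Sp_D(V,φ)` and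
  condition (D) in (…) is satisfied.»
* H. Lange, *Abelian Varieties over the Complex Numbers* (2023), §5.1.5 Exercise (2)(a) (PDF p0250 L3–L5: a non-simple
  abelian surface is isogenous to a product of two elliptic curves), §1.1.6 Exercise (1)(a) (every one-dimensional torus is
  `ℂ/(ℤτ + ℤ)`), §2.4.4 Thm. 2.4.25 ∕ Cor. 2.4.26 (Poincaré's complete reducibility).
* B. van Geemen, *An introduction to the Hodge conjecture for abelian varieties*, LNM 1594 (1994), §4 Thm. 4.3 (Tate:
  products of elliptic curves); B. B. Gordon, *A survey of the Hodge conjecture for abelian varieties* (1999), Thm. 7.5.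

## Contents

* §1 `isIsomorphic_piPeriod_two` (plumbing): `∏_{k<2} X_k ≅ X₀ × X₁` for a family of two tori.
* §2 **`IsRiemannForm.exists_isIsogenous_piPeriod_ellipticPeriod_of_not_isSimple_of_finrank_eq_two`** — a non-simple polarised
  abelian surface is isogenous to `E_{τ₁} × E_{τ₂}` (in the lane's currency `piPeriod fun k ↦ ellipticPeriod (hσ k)`,
  `σ = (τ₁, τ₂)`), and **`IsRiemannForm.forall_divisorClasses_powPeriod_eq_hodgeClasses_of_not_isSimple_of_finrank_eq_two`**
  (`ℬ•(Xⁿ) = 𝒟•(Xⁿ)` for every `n`), with the `IsAbelianVariety` form.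
* §3 **`IsRiemannForm.forall_divisorClasses_powPeriod_eq_hodgeClasses_of_finrank_eq_two_of_forall_not_isAlbertTypeIV`** —
  EVERY polarised abelian surface which is not a simple surface of Albert type IV is stably nondegenerate (g48-#2 for the
  simple ones), the variant «totally real centre if simple», and the `IsAbelianVariety` form.

NOT here: the simple CM surfaces (Type IV(2,1), «`Hg(X) = U_F`», the last entry of (2.2) at `g = 2`), recorded in g48-#2.
LOCATOR NOTE: the held TeX of [MoonenZarhin1999LowDim] has no statement numbers; «(2.2)» is the list of §2 (p0005 L53 ff.),
and the theorem «`Hg = L`, condition (D) for `dim ≤ 3`» that the lane's g47-#10 ∕ g48-#1 ∕ g48-#2 docstrings call «(2.4)» is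
PRINTED in the held text at §3, p0008 L107–L111 (and announced in the Introduction, p0001 L62–L64, and §2, p0005 L20–L22).
-/

noncomputable section

open Module Matrix NumberField
open Literature.RingTheory.CentralSimple (IsAlbertTypeIV)

namespace Literature.Geometry.Kaehler

namespace ComplexTorus

/-! ## §1 Plumbing: a family of two tori -/

section Two

variable {ι : Type*} [Fintype ι] [DecidableEq ι] {E : Type*} [NormedAddCommGroup E] [NormedSpace ℂ E]

/-- **`∏_{k<2} X_k ≅ X₀ × X₁`** for a family `(X₀, X₁)` of complex tori with a common ambient space (`∏_{k<2} X_k ≅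
(∏_{k<1} X_k) × X₁` and `∏_{k<1} X_k = X₀¹ ≅ X₀`). [cite: Lange2023AbelianVarietiesComplex, §1.1.2 (products of complex tori), p. 21] -/
theorem isIsomorphic_piPeriod_two (Φ : Fin 2 → ((ι → ℝ) ≃L[ℝ] E)) :
    IsIsomorphic (piPeriod Φ) (prodPeriod (Φ 0) (Φ 1)) := by
  have h := isIsomorphic_piPeriod_succ Φ
  have hconst : (fun k : Fin 1 ↦ Φ k.castSucc) = fun _ : Fin 1 ↦ Φ 0 :=
    funext fun k ↦ by rw [Subsingleton.elim k 0]; rfl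
  rw [hconst, piPeriod_const] at h
  exact h.trans ((isIsomorphic_powPeriod_one (Φ 0)).symm.prod (IsIsomorphic.refl (Φ 1)))

end Two

/-! ## §2 A non-simple abelian surface is isogenous to a product of two elliptic curves, hence stably nondegenerate -/

section NonSimple

variable {κ : Type} [Fintype κ] [DecidableEq κ] {E : Type} [NormedAddCommGroup E] [NormedSpace ℂ E]
  [FiniteDimensional ℂ E] {Ψ : (κ → ℝ) ≃L[ℝ] E} {η : E [⋀^Fin 2]→L[ℝ] ℝ}

/-- **A NON-SIMPLE POLARISED ABELIAN SURFACE IS ISOGENOUS TO A PRODUCT OF TWO ELLIPTIC CURVES `E_{τ₁} × E_{τ₂}`**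
(`E_τ = ℂ/(ℤτ + ℤ)`; here as the lane's finite product `piPeriod` of the family `k ↦ E_{σ_k}`, `σ = (τ₁, τ₂)`): Poincaré's
complete reducibility gives `X ∼ X₁ × X₂` with one-dimensional complex subtori, and every one-dimensional torus is an `E_τ`.
[cite: Lange2023AbelianVarietiesComplex, §5.1.5 Exercise (2)(a) (PDF p0250 L3–L5) and §1.1.6 Exercise (1)(a)]
[cite: MoonenZarhin1999LowDim, §3 (p0008 L107–L111: «for every complex abelian variety `X` of dimension `≤ 3` … condition (D) … is satisfied») and §3 Corollary (p0007 L80–L84)] -/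
theorem IsRiemannForm.exists_isIsogenous_piPeriod_ellipticPeriod_of_not_isSimple_of_finrank_eq_two (hη : IsRiemannForm Ψ η)
    (hg : finrank ℂ E = 2) (hX : ¬ IsSimple Ψ) :
    ∃ (σ : Fin 2 → ℂ) (hσ : ∀ k, (σ k).im ≠ 0), IsIsogenous Ψ (piPeriod fun k ↦ ellipticPeriod (hσ k)) := by
  obtain ⟨V, hV, hVc, hW, hWc, h1, h2, hiso, -⟩ := hη.exists_isIsogenous_prod_elliptic_of_not_isSimple hg hX
  -- the two factors are one-dimensional, hence elliptic curves
  have hd₁ : finrank ℂ (cxSpan Ψ V) = 1 := by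
    have h := subRank_eq_two_mul_finrank Ψ hV hVc
    omega
  have hd₂ : finrank ℂ (cxSpan Ψ (orthSubspace Ψ η V)) = 1 := by
    have h := subRank_eq_two_mul_finrank Ψ hW hWc
    omega
  obtain ⟨τ₁, hτ₁, e₁⟩ := exists_isIsomorphic_ellipticPeriod (subtorusPeriod Ψ V hV hVc) hd₁
  obtain ⟨τ₂, hτ₂, e₂⟩ := exists_isIsomorphic_ellipticPeriod (subtorusPeriod Ψ (orthSubspace Ψ η V) hW hWc) hd₂
  have hσ : ∀ k : Fin 2, ((![τ₁, τ₂] : Fin 2 → ℂ) k).im ≠ 0 := fun k ↦ by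
    fin_cases k
    · exact hτ₁
    · exact hτ₂
  refine ⟨![τ₁, τ₂], hσ, IsIsogenous.trans _ _ _ hiso (IsIsogenous.trans _ _ _ (e₁.prod e₂).isIsogenous ?_)⟩
  exact (isIsomorphic_piPeriod_two fun k ↦ ellipticPeriod (hσ k)).symm.isIsogenous

/-- **MOONEN–ZARHIN, CONDITION (D) FOR NON-SIMPLE ABELIAN SURFACES: `ℬ•(Xⁿ) = 𝒟•(Xⁿ)` for every `n`** — a non-simple polarised
abelian surface is isogenous to `E_{τ₁} × E_{τ₂}` and every product of elliptic curves is stably nondegenerate (Tate ∕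
MZ Cor. (3.9)), stable nondegeneracy being an isogeny invariant. [cite: MoonenZarhin1999LowDim, §3 Corollary (p0007 L80–L84: «every product of elliptic curves satisfies condition (D)») and §3 (p0008 L107–L111), Introduction (p0001 L62–L64)]
[cite: vanGeemen1994HodgeAV, §4 Thm. 4.3 (Tate)] [cite: Lange2023AbelianVarietiesComplex, §5.1.5 Exercise (2)(a)] -/
theorem IsRiemannForm.forall_divisorClasses_powPeriod_eq_hodgeClasses_of_not_isSimple_of_finrank_eq_two
    (hη : IsRiemannForm Ψ η) (hg : finrank ℂ E = 2) (hX : ¬ IsSimple Ψ) :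
    ∀ k p : ℕ, divisorClasses (powPeriod Ψ k) p = hodgeClasses (powPeriod Ψ k) p := by
  obtain ⟨σ, hσ, hiso⟩ := hη.exists_isIsogenous_piPeriod_ellipticPeriod_of_not_isSimple_of_finrank_eq_two hg hX
  exact hiso.forall_divisorClasses_powPeriod_eq_hodgeClasses_of_pi_ellipticPeriod hσ

/-- The `IsAbelianVariety` form: a non-simple complex abelian SURFACE is stably nondegenerate.
[cite: MoonenZarhin1999LowDim, §3 (p0008 L107–L111) and §3 Corollary (p0007 L80–L84)] [cite: vanGeemen1994HodgeAV, §4 Thm. 4.3] -/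
theorem IsAbelianVariety.forall_divisorClasses_powPeriod_eq_hodgeClasses_of_not_isSimple_of_finrank_eq_two
    (hA : IsAbelianVariety Ψ) (hg : finrank ℂ E = 2) (hX : ¬ IsSimple Ψ) :
    ∀ k p : ℕ, divisorClasses (powPeriod Ψ k) p = hodgeClasses (powPeriod Ψ k) p := by
  obtain ⟨η, hη⟩ := hA
  exact hη.forall_divisorClasses_powPeriod_eq_hodgeClasses_of_not_isSimple_of_finrank_eq_two hg hX

end NonSimple

/-! ## §3 Every abelian surface which is not a simple surface of type IV -/

section All

variable {κ : Type} [Fintype κ] [DecidableEq κ] [Nonempty κ] {E : Type} [NormedAddCommGroup E] [NormedSpace ℂ E]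
  [FiniteDimensional ℂ E] {Ψ : (κ → ℝ) ≃L[ℝ] E} {η : E [⋀^Fin 2]→L[ℝ] ℝ}

/-- **MOONEN–ZARHIN'S «CONDITION (D) FOR `dim X ≤ 3`» AT `g = 2`, ALL BUT ONE CASE: EVERY POLARISED ABELIAN SURFACE WHICH IS NOT A SIMPLE SURFACE OF ALBERT
TYPE IV IS STABLY NONDEGENERATE** (`ℬ•(Xⁿ) = 𝒟•(Xⁿ)` for every `n`): non-simple surfaces by §2 (products of elliptic curves),
simple surfaces of types I(1), I(2), II(1) by g48-#2 (`IsSimple.forall_divisorClasses_powPeriod_eq_hodgeClasses_of_not_isAlbertTypeIV_of_finrank_eq_two`);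
the hypothesis only concerns the Rosati pair of a simple `X` (type III never occurs).  The remaining entry of (2.2), Type
IV(2,1) («`End⁰(X) = F` a quartic CM-field … `Hg(X) = U_F`»), is not covered here. [cite: MoonenZarhin1999LowDim, §2 (2.2) `g = 2` (p0005 L53–L78), §2 (p0005 L20–L22) and §3 (p0008 L107–L111)]
[cite: Gordon1999HodgeAVSurvey, Thm. 7.5] [cite: vanGeemen1994HodgeAV, §4 Thm. 4.3] -/
theorem IsRiemannForm.forall_divisorClasses_powPeriod_eq_hodgeClasses_of_finrank_eq_two_of_forall_not_isAlbertTypeIV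
    (hη : IsRiemannForm Ψ η) (hg : finrank ℂ E = 2)
    (h : ∀ (hX : IsSimple Ψ) (G : Matrix κ κ ℚ) (hG : G.map (Rat.cast : ℚ → ℝ) = latticeGram Ψ η),
      ¬ IsAlbertTypeIV (centerField Ψ hX) (endAlgRat Ψ) (rosatiEnd Ψ hη.1 hη.2.2 hG)) :
    ∀ k p : ℕ, divisorClasses (powPeriod Ψ k) p = hodgeClasses (powPeriod Ψ k) p := by
  by_cases hX : IsSimple Ψ
  · obtain ⟨G, hG⟩ := hη.exists_ratMatrix_latticeGram
    exact hX.forall_divisorClasses_powPeriod_eq_hodgeClasses_of_not_isAlbertTypeIV_of_finrank_eq_two hη hG (h hX G hG) hg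
  · exact hη.forall_divisorClasses_powPeriod_eq_hodgeClasses_of_not_isSimple_of_finrank_eq_two hg hX

/-- **EVERY POLARISED ABELIAN SURFACE WHOSE ENDOMORPHISM ALGEBRA, IF `X` IS SIMPLE, HAS TOTALLY REAL CENTRE IS STABLY
NONDEGENERATE** (`End⁰(X) = ℚ`, a real quadratic field or an indefinite quaternion algebra over `ℚ`, or `X` non-simple).
[cite: MoonenZarhin1999LowDim, §2 (2.2) `g = 2` (p0005 L53–L78) and §3 (p0008 L107–L111)] [cite: Lange2023AbelianVarietiesComplex, §5.1.5 Exercise (2)(a),(b)] -/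
theorem IsRiemannForm.forall_divisorClasses_powPeriod_eq_hodgeClasses_of_finrank_eq_two_of_forall_isTotallyReal
    (hη : IsRiemannForm Ψ η) (hg : finrank ℂ E = 2) (h : ∀ hX : IsSimple Ψ, IsTotallyReal (centerField Ψ hX)) :
    ∀ k p : ℕ, divisorClasses (powPeriod Ψ k) p = hodgeClasses (powPeriod Ψ k) p := by
  by_cases hX : IsSimple Ψ
  · obtain ⟨G, hG⟩ := hη.exists_ratMatrix_latticeGram
    haveI := h hX
    exact hX.forall_divisorClasses_powPeriod_eq_hodgeClasses_of_isTotallyReal_of_finrank_eq_two hη hG hg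
  · exact hη.forall_divisorClasses_powPeriod_eq_hodgeClasses_of_not_isSimple_of_finrank_eq_two hg hX

/-- The `IsAbelianVariety` form: a complex abelian surface whose endomorphism algebra, if the surface is simple, has totally
real centre, is stably nondegenerate — `ℬ•(Xⁿ) = 𝒟•(Xⁿ)` for every `n`, all Hodge classes on all powers algebraic.
[cite: MoonenZarhin1999LowDim, §3 (p0008 L107–L111) and Introduction (p0001 L62–L64)] [cite: Gordon1999HodgeAVSurvey, Thm. 7.5] -/
theorem IsAbelianVariety.forall_divisorClasses_powPeriod_eq_hodgeClasses_of_finrank_eq_two_of_forall_isTotallyReal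
    (hA : IsAbelianVariety Ψ) (hg : finrank ℂ E = 2) (h : ∀ hX : IsSimple Ψ, IsTotallyReal (centerField Ψ hX)) :
    ∀ k p : ℕ, divisorClasses (powPeriod Ψ k) p = hodgeClasses (powPeriod Ψ k) p := by
  obtain ⟨η, hη⟩ := hA
  exact hη.forall_divisorClasses_powPeriod_eq_hodgeClasses_of_finrank_eq_two_of_forall_isTotallyReal hg h

end All

end ComplexTorus

end Literature.Geometry.Kaehler
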